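import Summits.AtomisticToContinuum.HydrodynamicLimit.Theorems.CorrectorPressureDecay.Negative.DiscreteCertificate

/-!
# Negative knowledge for `CorrectorPressureDecay` (stmt-AtomisticToContinuum-14135): window comparison lemmas for
measure-preserving semigroups (drefute gen 3, file 3/4)

Refuter `refuter-drefute-stmt-AtomisticToContinuum-14135-g3-0`, 2026-08-16. Abstract tools consumed by
`Negative/DiscreteWindowOfKineticFlux.lean` (file 4/4: `KineticFluxLdDecay → DiscreteWindowPressureDecay`, the paper step of
drefute gen 2's sandwich made a Lean theorem). For an everywhere-defined jointly measurable measure-preserving semigroup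
`θ` on a probability space and a bounded measurable `F` (sorry-free):

* `lintegral_exp_window_le_of_short` — LONG WINDOWS FROM ONE WINDOW: if `∫ exp(L⁻¹∫₀ᴸ F∘θ_s) dμ ≤ K` (`K ≥ 1`) then
  `∫ exp(T⁻¹∫₀ᵀ F∘θ_s) dμ ≤ e^{C_F L/T} K` for every `T ≥ L`: `[0, T]` = `⌊T/L⌋` shifted `L`-blocks + a remainder shorter
  than `L`; the remainder enters MULTIPLICATIVELY (`e^{C_F L/T}`), the blocks through convexity of `exp` (weights `mL/T`,
  `1 − mL/T` at the points (block average, 0), then the `m`-point average) and invariance. This replaces the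
  Hölder-subadditivity argument `∃τ ⇒ ∀H ≥ H₁` of the 10967 docstring.
* `lintegral_abs_discAvg_sub_window_le` — DISCRETE VS CONTINUOUS averages in `L¹(μ)`: the right-endpoint sample of each
  block sits to the RIGHT of every point of its block by at most `T/n`, so `∫ |n⁻¹Σ_{j=1}^{n} F∘θ_{jT/n} − T⁻¹∫₀ᵀ F∘θ_u| dμ`
  is bounded by the `L¹` cost of right shifts `≤ T/n` (Tonelli, `lintegral_ofReal_intervalIntegral_abs_le`). No Riemann sums:
  right-continuity of the Koopman shift (file 2/4) makes this small at fixed `(N, Φ)`.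
Nothing here asserts a Theses decl.
-/

noncomputable section

open MeasureTheory ProbabilityTheory InformationTheory Set Filter Topology
open scoped ENNReal

namespace Summit.AtomisticToContinuum.HydrodynamicLimit.Theorems.CorrectorPressureDecayNegative.DiscreteWindow

open Summit.AtomisticToContinuum.HydrodynamicLimit.Theorems.AntiMazurCoboundariesExponentialCertificate
  (intervalIntegrable_of_bounded measurable_intervalIntegral_comp)

section Abstract

variable {X : Type*} [MeasurableSpace X] (θ : ℝ × X → X)

/-- Invariance of the shift modulus for an everywhere-defined measure-preserving semigroup. [folklore] -/
theorem lintegral_abs_sub_shift_semigroup (hθ : ∀ t, Measurable fun z => θ (t, z))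
    (hsg : ∀ s t z, θ (s + t, z) = θ (s, θ (t, z))) (μ : Measure X)
    (hinv : ∀ t, MeasurePreserving (fun z => θ (t, z)) μ μ) {F : X → ℝ} (hF : Measurable F) (u t : ℝ) :
    ∫⁻ z, ENNReal.ofReal |F (θ (u + t, z)) - F (θ (t, z))| ∂μ = ∫⁻ z, ENNReal.ofReal |F (θ (u, z)) - F z| ∂μ := by
  have hm : Measurable fun w => ENNReal.ofReal |F (θ (u, w)) - F w| :=
    ((hF.comp (hθ u)).sub hF).abs.ennreal_ofReal
  simp only [hsg]
  exact (hinv t).lintegral_comp hm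

/-- Window integrals of a two-point difference are measurable in the initial datum (joint measurability). [folklore] -/
theorem measurable_intervalIntegral_abs_sub (hθ : Measurable θ) {F : X → ℝ} (hF : Measurable F) (t : ℝ)
    {a b : ℝ} (hab : a ≤ b) : Measurable fun z => ∫ u in a..b, |F (θ (t, z)) - F (θ (u, z))| := by
  simp only [intervalIntegral.integral_of_le hab]
  have hθt : Measurable fun z => θ (t, z) := hθ.comp measurable_prodMk_left
  have hsm : StronglyMeasurable fun p : ℝ × X => |F (θ (t, p.2)) - F (θ p)| :=
    ((hF.comp (hθt.comp measurable_snd)).sub (hF.comp hθ)).abs.stronglyMeasurable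
  exact (hsm.integral_prod_left' (μ := volume.restrict (Ioc a b))).measurable

/-- **Tonelli for the shift modulus**: if `∫ |F∘θ_t − F∘θ_u| dμ ≤ ε` for all `u ∈ [a, b]` then
`∫ (∫_a^b |F∘θ_t − F∘θ_u| du) dμ ≤ (b − a) ε`. [folklore] -/
theorem lintegral_ofReal_intervalIntegral_abs_le (hθ : Measurable θ) (μ : Measure X) [SFinite μ]
    {F : X → ℝ} (hF : Measurable F) {CF : ℝ} (hCF : ∀ z, |F z| ≤ CF) (t : ℝ) {a b : ℝ} (hab : a ≤ b)
    {ε : ℝ≥0∞} (hε : ∀ u ∈ Icc a b, ∫⁻ z, ENNReal.ofReal |F (θ (t, z)) - F (θ (u, z))| ∂μ ≤ ε) :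
    ∫⁻ z, ENNReal.ofReal (∫ u in a..b, |F (θ (t, z)) - F (θ (u, z))|) ∂μ ≤ ENNReal.ofReal (b - a) * ε := by
  have hθs : ∀ z, Measurable fun s : ℝ => θ (s, z) := fun z => hθ.comp measurable_prodMk_right
  have hθt : Measurable fun z => θ (t, z) := hθ.comp measurable_prodMk_left
  have hdm : ∀ z, Measurable fun u : ℝ => |F (θ (t, z)) - F (θ (u, z))| := fun z =>
    (measurable_const.sub (hF.comp (hθs z))).abs
  have hdb : ∀ z u, |(|F (θ (t, z)) - F (θ (u, z))|)| ≤ CF + CF := fun z u => by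
    rw [abs_abs]; exact (abs_sub _ _).trans (add_le_add (hCF _) (hCF _))
  have step1 : ∀ z, ENNReal.ofReal (∫ u in a..b, |F (θ (t, z)) - F (θ (u, z))|) =
      ∫⁻ u in Ioc a b, ENNReal.ofReal |F (θ (t, z)) - F (θ (u, z))| := by
    intro z
    rw [intervalIntegral.integral_of_le hab]
    refine ofReal_integral_eq_lintegral_ofReal ?_ (ae_of_all _ fun u => abs_nonneg _)
    exact (intervalIntegrable_of_bounded (hdm z) (hdb z) a b).1
  simp only [step1]
  have hm2 : Measurable (Function.uncurry fun (z : X) (u : ℝ) => ENNReal.ofReal |F (θ (t, z)) - F (θ (u, z))|) := by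
    have h1 : Measurable fun p : X × ℝ => F (θ (t, p.1)) := hF.comp (hθt.comp measurable_fst)
    have h2 : Measurable fun p : X × ℝ => F (θ (p.2, p.1)) := hF.comp (hθ.comp measurable_swap)
    exact (h1.sub h2).abs.ennreal_ofReal
  rw [lintegral_lintegral_swap (μ := μ) (ν := volume.restrict (Ioc a b)) hm2.aemeasurable]
  calc ∫⁻ u in Ioc a b, ∫⁻ z, ENNReal.ofReal |F (θ (t, z)) - F (θ (u, z))| ∂μ
      ≤ ∫⁻ _u in Ioc a b, ε := setLIntegral_mono' measurableSet_Ioc fun u hu => hε u ⟨hu.1.le, hu.2⟩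
    _ = ENNReal.ofReal (b - a) * ε := by rw [setLIntegral_const, Real.volume_Ioc, mul_comm]

/-- **Discrete versus continuous window averages in `L¹`**: if every right shift by at most `T/n` costs at most `ε`
in `L¹(μ)`, then `∫ |n⁻¹ Σ_{j=1}^{n} F∘θ_{jT/n} − T⁻¹∫₀ᵀ F∘θ_u du| dμ ≤ ε`. [folklore] -/
theorem lintegral_abs_discAvg_sub_window_le (hθ : Measurable θ) (μ : Measure X) [SFinite μ]
    {F : X → ℝ} (hF : Measurable F) {CF : ℝ} (hCF : ∀ z, |F z| ≤ CF) {T : ℝ} (hT : 0 < T) {n : ℕ} (hn : 1 ≤ n)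
    {ε : ℝ≥0∞} (hε : ∀ t u : ℝ, 0 ≤ u → u ≤ t → t ≤ u + T / n →
      ∫⁻ z, ENNReal.ofReal |F (θ (t, z)) - F (θ (u, z))| ∂μ ≤ ε) :
    ∫⁻ z, ENNReal.ofReal |(n : ℝ)⁻¹ * ∑ j : Fin n, F (θ ((((j : ℕ) : ℝ) + 1) * (T / n), z)) -
        T⁻¹ * ∫ u in (0 : ℝ)..T, F (θ (u, z))| ∂μ ≤ ε := by
  have hn' : (0 : ℝ) < n := by exact_mod_cast hn
  set s : ℝ := T / n with hs_def
  have hs : 0 < s := div_pos hT hn'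
  have hns : (n : ℝ) * s = T := by rw [hs_def]; field_simp
  have hθs : ∀ z, Measurable fun u : ℝ => θ (u, z) := fun z => hθ.comp measurable_prodMk_right
  have hForb : ∀ z (a b : ℝ), IntervalIntegrable (fun u => F (θ (u, z))) volume a b := fun z a b =>
    intervalIntegrable_of_bounded (hF.comp (hθs z)) (fun u => hCF _) a b
  -- block decomposition of the window integral
  have hsplit : ∀ z, ∫ u in (0 : ℝ)..T, F (θ (u, z)) =
      ∑ j ∈ Finset.range n, ∫ u in ((j : ℝ) * s)..(((j + 1 : ℕ) : ℝ) * s), F (θ (u, z)) := by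
    intro z
    have h := intervalIntegral.sum_integral_adjacent_intervals (a := fun k : ℕ => (k : ℝ) * s) (n := n)
      (fun k _ => hForb z _ _)
    simp only [Nat.cast_zero, zero_mul] at h
    rw [hns] at h
    exact h.symm
  -- the pathwise bound
  have pt : ∀ z, |(n : ℝ)⁻¹ * ∑ j : Fin n, F (θ ((((j : ℕ) : ℝ) + 1) * s, z)) - T⁻¹ * ∫ u in (0 : ℝ)..T, F (θ (u, z))| ≤
      (n : ℝ)⁻¹ * ∑ j : Fin n, s⁻¹ *
        ∫ u in (((j : ℕ) : ℝ) * s)..((((j : ℕ) : ℝ) + 1) * s), |F (θ ((((j : ℕ) : ℝ) + 1) * s, z)) - F (θ (u, z))| := by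
    intro z
    have hT' : T⁻¹ = (n : ℝ)⁻¹ * s⁻¹ := by rw [← hns, mul_inv]
    have e1 : T⁻¹ * ∫ u in (0 : ℝ)..T, F (θ (u, z)) =
        (n : ℝ)⁻¹ * ∑ j : Fin n, s⁻¹ * ∫ u in (((j : ℕ) : ℝ) * s)..((((j : ℕ) : ℝ) + 1) * s), F (θ (u, z)) := by
      rw [hsplit z, hT', mul_assoc, Finset.mul_sum, ← Fin.sum_univ_eq_sum_range]
      congr 1
      refine Finset.sum_congr rfl fun j _ => ?_
      push_cast
      ring_nf
    have e2 : ∀ j : Fin n, F (θ ((((j : ℕ) : ℝ) + 1) * s, z)) =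
        s⁻¹ * ∫ _u in (((j : ℕ) : ℝ) * s)..((((j : ℕ) : ℝ) + 1) * s), F (θ ((((j : ℕ) : ℝ) + 1) * s, z)) := by
      intro j
      rw [intervalIntegral.integral_const, smul_eq_mul]
      have : (((j : ℕ) : ℝ) + 1) * s - ((j : ℕ) : ℝ) * s = s := by ring
      rw [this, ← mul_assoc, inv_mul_cancel₀ hs.ne', one_mul]
    have e3 : (n : ℝ)⁻¹ * ∑ j : Fin n, F (θ ((((j : ℕ) : ℝ) + 1) * s, z)) - T⁻¹ * ∫ u in (0 : ℝ)..T, F (θ (u, z)) =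
        (n : ℝ)⁻¹ * ∑ j : Fin n, s⁻¹ *
          ∫ u in (((j : ℕ) : ℝ) * s)..((((j : ℕ) : ℝ) + 1) * s), (F (θ ((((j : ℕ) : ℝ) + 1) * s, z)) - F (θ (u, z))) := by
      rw [e1, ← mul_sub, ← Finset.sum_sub_distrib]
      congr 1
      refine Finset.sum_congr rfl fun j _ => ?_
      rw [intervalIntegral.integral_sub intervalIntegrable_const (hForb z _ _), mul_sub, ← e2 j]
    rw [e3, abs_mul, abs_of_pos (inv_pos.2 hn')]
    refine mul_le_mul_of_nonneg_left ((Finset.abs_sum_le_sum_abs _ _).trans (Finset.sum_le_sum fun j _ => ?_))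
      (inv_pos.2 hn').le
    rw [abs_mul, abs_of_pos (inv_pos.2 hs)]
    refine mul_le_mul_of_nonneg_left (intervalIntegral.abs_integral_le_integral_abs ?_) (inv_pos.2 hs).le
    nlinarith
  -- integrate
  have hI0 : ∀ z (j : Fin n), 0 ≤ ∫ u in (((j : ℕ) : ℝ) * s)..((((j : ℕ) : ℝ) + 1) * s),
      |F (θ ((((j : ℕ) : ℝ) + 1) * s, z)) - F (θ (u, z))| := fun z j =>
    intervalIntegral.integral_nonneg (by nlinarith) fun u _ => abs_nonneg _
  have hIm : ∀ j : Fin n, Measurable fun z => ENNReal.ofReal (∫ u in (((j : ℕ) : ℝ) * s)..((((j : ℕ) : ℝ) + 1) * s),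
      |F (θ ((((j : ℕ) : ℝ) + 1) * s, z)) - F (θ (u, z))|) := fun j =>
    ENNReal.measurable_ofReal.comp (measurable_intervalIntegral_abs_sub θ hθ hF _ (by nlinarith))
  have each : ∀ j : Fin n, ∫⁻ z, ENNReal.ofReal (∫ u in (((j : ℕ) : ℝ) * s)..((((j : ℕ) : ℝ) + 1) * s),
      |F (θ ((((j : ℕ) : ℝ) + 1) * s, z)) - F (θ (u, z))|) ∂μ ≤ ENNReal.ofReal s * ε := by
    intro j
    have hj0 : (0 : ℝ) ≤ ((j : ℕ) : ℝ) * s := by positivity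
    have h := lintegral_ofReal_intervalIntegral_abs_le θ hθ μ hF hCF ((((j : ℕ) : ℝ) + 1) * s)
      (by nlinarith : ((j : ℕ) : ℝ) * s ≤ (((j : ℕ) : ℝ) + 1) * s) (ε := ε) fun u hu =>
        hε _ _ (hj0.trans hu.1) hu.2 (by linarith [hu.1])
    have e : (((j : ℕ) : ℝ) + 1) * s - ((j : ℕ) : ℝ) * s = s := by ring
    rwa [e] at h
  calc ∫⁻ z, ENNReal.ofReal |(n : ℝ)⁻¹ * ∑ j : Fin n, F (θ ((((j : ℕ) : ℝ) + 1) * s, z)) -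
          T⁻¹ * ∫ u in (0 : ℝ)..T, F (θ (u, z))| ∂μ
      ≤ ∫⁻ z, ENNReal.ofReal ((n : ℝ)⁻¹) * ∑ j : Fin n, (ENNReal.ofReal s⁻¹ *
          ENNReal.ofReal (∫ u in (((j : ℕ) : ℝ) * s)..((((j : ℕ) : ℝ) + 1) * s),
            |F (θ ((((j : ℕ) : ℝ) + 1) * s, z)) - F (θ (u, z))|)) ∂μ := by
        refine lintegral_mono fun z => (ENNReal.ofReal_le_ofReal (pt z)).trans (le_of_eq ?_)
        rw [ENNReal.ofReal_mul (inv_pos.2 hn').le, ENNReal.ofReal_sum_of_nonneg fun j _ =>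
          mul_nonneg (inv_pos.2 hs).le (hI0 z j)]
        congr 1
        exact Finset.sum_congr rfl fun j _ => by rw [ENNReal.ofReal_mul (inv_pos.2 hs).le]
    _ = ENNReal.ofReal ((n : ℝ)⁻¹) * ∑ j : Fin n, (ENNReal.ofReal s⁻¹ *
          ∫⁻ z, ENNReal.ofReal (∫ u in (((j : ℕ) : ℝ) * s)..((((j : ℕ) : ℝ) + 1) * s),
            |F (θ ((((j : ℕ) : ℝ) + 1) * s, z)) - F (θ (u, z))|) ∂μ) := by
        rw [lintegral_const_mul _ (Finset.measurable_sum _ fun j _ => (hIm j).const_mul _),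
          lintegral_finsetSum _ fun j _ => (hIm j).const_mul _]
        congr 1
        exact Finset.sum_congr rfl fun j _ => by rw [lintegral_const_mul _ (hIm j)]
    _ ≤ ENNReal.ofReal ((n : ℝ)⁻¹) * ∑ _j : Fin n, (ENNReal.ofReal s⁻¹ * (ENNReal.ofReal s * ε)) :=
        mul_le_mul' le_rfl (Finset.sum_le_sum fun j _ => mul_le_mul' le_rfl (each j))
    _ = ε := by
        rw [← mul_assoc, ← ENNReal.ofReal_mul (inv_pos.2 hs).le, inv_mul_cancel₀ hs.ne', ENNReal.ofReal_one,
          one_mul, Finset.sum_const, Finset.card_univ, Fintype.card_fin, nsmul_eq_mul, ← mul_assoc,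
          ENNReal.ofReal_inv_of_pos hn', ENNReal.ofReal_natCast,
          ENNReal.inv_mul_cancel (by exact_mod_cast hn'.ne') (ENNReal.natCast_ne_top n), one_mul]

/-- **Long windows from one window.** For an everywhere-defined jointly measurable measure-preserving semigroup, a
measurable `|F| ≤ C_F`, `0 < L ≤ T` and `1 ≤ K`: if `∫ exp(L⁻¹∫₀ᴸ F∘θ_s ds) dμ ≤ K` then
`∫ exp(T⁻¹∫₀ᵀ F∘θ_s ds) dμ ≤ e^{C_F L/T} · K` — `[0,T]` = `m = ⌊T/L⌋` blocks (each a shifted `L`-window) + a remainder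
shorter than `L` (a multiplicative factor `e^{C_F L/T}`); convexity of `exp` with weights `mL/T, 1 − mL/T` at the points
(block average, `0`) and on the `m` blocks; invariance. [folklore] -/
theorem lintegral_exp_window_le_of_short (hθ : Measurable θ) (hsg : ∀ s t z, θ (s + t, z) = θ (s, θ (t, z)))
    (μ : Measure X) [IsProbabilityMeasure μ] (hinv : ∀ t, MeasurePreserving (fun z => θ (t, z)) μ μ)
    {F : X → ℝ} (hF : Measurable F) {CF : ℝ} (hCF : ∀ z, |F z| ≤ CF) {L T : ℝ} (hL : 0 < L) (hLT : L ≤ T)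
    {K : ℝ≥0∞} (hK1 : 1 ≤ K) (hK : ∫⁻ z, ENNReal.ofReal (Real.exp (L⁻¹ * ∫ s in (0 : ℝ)..L, F (θ (s, z)))) ∂μ ≤ K) :
    ∫⁻ z, ENNReal.ofReal (Real.exp (T⁻¹ * ∫ s in (0 : ℝ)..T, F (θ (s, z)))) ∂μ ≤
      ENNReal.ofReal (Real.exp (CF * L / T)) * K := by
  have hT : 0 < T := hL.trans_le hLT
  have hθt : ∀ t, Measurable fun z => θ (t, z) := fun t => hθ.comp measurable_prodMk_left
  have hθs : ∀ z, Measurable fun u : ℝ => θ (u, z) := fun z => hθ.comp measurable_prodMk_right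
  have hForb : ∀ z (a b : ℝ), IntervalIntegrable (fun u => F (θ (u, z))) volume a b := fun z a b =>
    intervalIntegrable_of_bounded (hF.comp (hθs z)) (fun u => hCF _) a b
  -- the integer number of blocks and the remainder
  set m : ℕ := ⌊T / L⌋₊ with hm_def
  have hTL1 : 1 ≤ T / L := by rw [le_div_iff₀ hL, one_mul]; exact hLT
  have hm1 : 1 ≤ m := by
    have h := Nat.floor_le_floor hTL1
    rwa [Nat.floor_one] at h
  have hm' : (0 : ℝ) < m := by exact_mod_cast hm1
  have hm_le : (m : ℝ) ≤ T / L := Nat.floor_le (by positivity)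
  have hm_gt : T / L < m + 1 := Nat.lt_floor_add_one _
  have hmL : (m : ℝ) * L ≤ T := by rwa [le_div_iff₀ hL] at hm_le
  have hmL' : T < (m + 1) * L := by rwa [div_lt_iff₀ hL] at hm_gt
  -- the weight of the blocks
  set w : ℝ := m * L / T with hw_def
  have hw0 : 0 ≤ w := by positivity
  have hw1 : w ≤ 1 := by rw [hw_def, div_le_one hT]; exact hmL
  -- window averages
  set avgL : X → ℝ := fun z => L⁻¹ * ∫ s in (0 : ℝ)..L, F (θ (s, z)) with havgL
  have havgLm : Measurable avgL := (measurable_intervalIntegral_comp θ hθ hF hL.le).const_mul _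
  -- block decomposition: `∫_0^T = Σ_{k<m} L · avgL (θ_{kL} z) + ∫_{mL}^T`
  have hsplit : ∀ z, ∫ s in (0 : ℝ)..T, F (θ (s, z)) =
      L * ∑ k : Fin m, avgL (θ (((k : ℕ) : ℝ) * L, z)) + ∫ s in ((m : ℝ) * L)..T, F (θ (s, z)) := by
    intro z
    have h1 := intervalIntegral.sum_integral_adjacent_intervals (a := fun k : ℕ => (k : ℝ) * L) (n := m)
      (fun k _ => hForb z _ _)
    simp only [Nat.cast_zero, zero_mul] at h1
    have hblock : ∀ k : ℕ, ∫ s in ((k : ℝ) * L)..(((k + 1 : ℕ) : ℝ) * L), F (θ (s, z)) = L * avgL (θ ((k : ℝ) * L, z)) := by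
      intro k
      have e1 : ∫ s in (0 : ℝ)..L, F (θ (s, θ ((k : ℝ) * L, z))) = ∫ s in (0 : ℝ)..L, F (θ (s + (k : ℝ) * L, z)) := by
        refine intervalIntegral.integral_congr fun s _ => ?_
        simp only [hsg]
      rw [havgL]
      simp only
      rw [← mul_assoc, mul_inv_cancel₀ hL.ne', one_mul, e1,
        intervalIntegral.integral_comp_add_right (fun x => F (θ (x, z))) ((k : ℝ) * L), zero_add]
      congr 1
      push_cast
      ring
    rw [← intervalIntegral.integral_add_adjacent_intervals (hForb z 0 ((m : ℝ) * L)) (hForb z _ T), ← h1,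
      Finset.mul_sum, ← Fin.sum_univ_eq_sum_range]
    congr 1
    exact Finset.sum_congr rfl fun k _ => hblock k
  -- the remainder is small
  have hrem : ∀ z, |T⁻¹ * ∫ s in ((m : ℝ) * L)..T, F (θ (s, z))| ≤ CF * L / T := by
    intro z
    have hCF0 : 0 ≤ CF := (abs_nonneg _).trans (hCF z)
    have h1 : ‖∫ s in ((m : ℝ) * L)..T, F (θ (s, z))‖ ≤ CF * |T - m * L| :=
      intervalIntegral.norm_integral_le_of_norm_le_const fun s _ => by
        rw [Real.norm_eq_abs]; exact hCF _
    rw [Real.norm_eq_abs] at h1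
    rw [abs_mul, abs_of_pos (inv_pos.2 hT)]
    have h2 : |T - m * L| ≤ L := by
      rw [abs_of_nonneg (by linarith)]
      linarith
    calc T⁻¹ * |∫ s in ((m : ℝ) * L)..T, F (θ (s, z))| ≤ T⁻¹ * (CF * L) :=
          mul_le_mul_of_nonneg_left (h1.trans (mul_le_mul_of_nonneg_left h2 hCF0)) (inv_pos.2 hT).le
      _ = CF * L / T := by ring
  -- pointwise bound
  have pt : ∀ z, Real.exp (T⁻¹ * ∫ s in (0 : ℝ)..T, F (θ (s, z))) ≤
      Real.exp (CF * L / T) * (w * ((m : ℝ)⁻¹ * ∑ k : Fin m, Real.exp (avgL (θ (((k : ℕ) : ℝ) * L, z)))) + (1 - w)) := by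
    intro z
    set Z : ℝ := (m : ℝ)⁻¹ * ∑ k : Fin m, avgL (θ (((k : ℕ) : ℝ) * L, z)) with hZ
    have e1 : T⁻¹ * ∫ s in (0 : ℝ)..T, F (θ (s, z)) = w * Z + T⁻¹ * ∫ s in ((m : ℝ) * L)..T, F (θ (s, z)) := by
      rw [hsplit z, mul_add, hZ, hw_def]
      congr 1
      field_simp
    rw [e1, Real.exp_add, mul_comm]
    refine mul_le_mul ((Real.exp_le_exp.2 ((le_abs_self _).trans (hrem z)))) ?_ (Real.exp_nonneg _)
      (Real.exp_nonneg _)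
    have hconv := convexOn_exp.2 (Set.mem_univ Z) (Set.mem_univ (0 : ℝ)) hw0 (sub_nonneg.2 hw1) (by ring)
    simp only [smul_eq_mul, mul_zero, add_zero, Real.exp_zero, mul_one] at hconv
    refine hconv.trans (add_le_add (mul_le_mul_of_nonneg_left ?_ hw0) le_rfl)
    rw [hZ]
    exact exp_avg_le hm1 _
  -- integrate
  have hEm : Measurable fun z => Real.exp (avgL z) := havgLm.exp
  have hI : ∫⁻ z, ENNReal.ofReal ((m : ℝ)⁻¹ * ∑ k : Fin m, Real.exp (avgL (θ (((k : ℕ) : ℝ) * L, z)))) ∂μ =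
      ∫⁻ z, ENNReal.ofReal (Real.exp (avgL z)) ∂μ :=
    lintegral_avg_comp_eq θ hθt μ hinv hEm (fun z => Real.exp_nonneg _) hm1 (fun k : Fin m => ((k : ℕ) : ℝ) * L)
  have hnn : ∀ z, 0 ≤ (m : ℝ)⁻¹ * ∑ k : Fin m, Real.exp (avgL (θ (((k : ℕ) : ℝ) * L, z))) := fun z =>
    mul_nonneg (inv_nonneg.2 hm'.le) (Finset.sum_nonneg fun k _ => Real.exp_nonneg _)
  have hSm : Measurable fun z => ENNReal.ofReal ((m : ℝ)⁻¹ * ∑ k : Fin m, Real.exp (avgL (θ (((k : ℕ) : ℝ) * L, z)))) :=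
    ENNReal.measurable_ofReal.comp ((Finset.measurable_sum _ fun k _ => (havgLm.comp (hθt _)).exp).const_mul _)
  have hK' : ∫⁻ z, ENNReal.ofReal (Real.exp (avgL z)) ∂μ ≤ K := by
    refine le_of_eq_of_le (lintegral_congr fun z => ?_) hK
    rw [havgL]
  calc ∫⁻ z, ENNReal.ofReal (Real.exp (T⁻¹ * ∫ s in (0 : ℝ)..T, F (θ (s, z)))) ∂μ
      ≤ ∫⁻ z, ENNReal.ofReal (Real.exp (CF * L / T)) * (ENNReal.ofReal w *
          ENNReal.ofReal ((m : ℝ)⁻¹ * ∑ k : Fin m, Real.exp (avgL (θ (((k : ℕ) : ℝ) * L, z)))) +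
            ENNReal.ofReal (1 - w)) ∂μ := by
        refine lintegral_mono fun z => (ENNReal.ofReal_le_ofReal (pt z)).trans (le_of_eq ?_)
        rw [ENNReal.ofReal_mul (Real.exp_nonneg _), ENNReal.ofReal_add (mul_nonneg hw0 (hnn z)) (sub_nonneg.2 hw1),
          ENNReal.ofReal_mul hw0]
    _ = ENNReal.ofReal (Real.exp (CF * L / T)) * (ENNReal.ofReal w *
          ∫⁻ z, ENNReal.ofReal ((m : ℝ)⁻¹ * ∑ k : Fin m, Real.exp (avgL (θ (((k : ℕ) : ℝ) * L, z)))) ∂μ +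
            ENNReal.ofReal (1 - w)) := by
        have hm3 : Measurable fun z => ENNReal.ofReal w *
            ENNReal.ofReal ((m : ℝ)⁻¹ * ∑ k : Fin m, Real.exp (avgL (θ (((k : ℕ) : ℝ) * L, z)))) +
              ENNReal.ofReal (1 - w) := (hSm.const_mul _).add measurable_const
        have hm4 : Measurable fun z => ENNReal.ofReal w *
            ENNReal.ofReal ((m : ℝ)⁻¹ * ∑ k : Fin m, Real.exp (avgL (θ (((k : ℕ) : ℝ) * L, z)))) := hSm.const_mul _
        rw [lintegral_const_mul _ hm3, lintegral_add_left hm4, lintegral_const_mul _ hSm, lintegral_const,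
          measure_univ, mul_one]
    _ ≤ ENNReal.ofReal (Real.exp (CF * L / T)) * (ENNReal.ofReal w * K + ENNReal.ofReal (1 - w) * K) := by
        rw [hI]
        refine mul_le_mul' le_rfl (add_le_add (mul_le_mul' le_rfl hK') ?_)
        exact le_mul_of_one_le_right (zero_le) hK1
    _ = ENNReal.ofReal (Real.exp (CF * L / T)) * K := by
        rw [← add_mul, ← ENNReal.ofReal_add hw0 (sub_nonneg.2 hw1), add_sub_cancel, ENNReal.ofReal_one, one_mul]

end Abstract

end Summit.AtomisticToContinuum.HydrodynamicLimit.Theorems.CorrectorPressureDecayNegative.DiscreteWindow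

end
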